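import Summits.QuantumFields.YangMills.Theorems.BalabanLadderUVSeamRecColdWallSplitElementaryWindow
import Summits.QuantumFields.YangMills.Theorems.BalabanLadderUVSeamRecCarrierExpMomentUniform
import Summits.QuantumFields.YangMills.Theorems.WeakCouplingRatesEventuallyPow
import HarnessLib

/-!
# Crux `UVSeamRec` (stmt-QuantumFields-20043), line `coldwall_pure`: both β-FREE binders are THEOREMS on the polynomial window

Helper file (`--supports stmt-QuantumFields-20043`) of the LEAD seat `ym-spine-20043-p1` (gen 18); companion of `…CarrierFlatGlue` (the β-free
carrier `carrierCl C 1 1 R = R⁴·cr/C` replaces the bare-weighted `carrierCl C 1 β R = β·R⁴·cr/C`, whose β-uniform exponential moments are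
incompatible with the running coupling at physical scales — memo `FINDING-20043-g18-running-coupling.md`).

* §1 (CW♭) — «`(R⁴/C₁)|kerE^η(plane q x) − kerE^𝟙(plane q x)| ≤ A₂ + carrierCl C_s 1 1 R q x η` for EVERY exterior» — holds on the whole window
  `R + 1 ≤ ⌈β^θ⌉`, every `0 < θ < 1/8`, any `0 < C_s ≤ C₁`, `A₂ > 0` (`coldWallSplitFlat_window`): LEAD g16's tilt inequality pays the classical part
  with coefficient ONE, so the bare weight `β` of the registered carrier was idle there (`coldWallSplit_inequality_of_slop_le` at the β-scaled constant
  `C_s·β`); `coldWallSplitFlat_of_femtoTail` glues the window to the TAIL `⌈β^{1/9}⌉ ≤ R + 2` (the open stub of the reshape).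
* §2 (EM♭) — «`⟨exp(2 Σ_{i∈T} carrierCl C 1 1 R (q i) (x i))⟩_{2L+1,β} ≤ e^{B·#T}`» — holds on the window `R + 2 ≤ ⌈β^θ⌉`, every `0 < θ < 1/8`, any
  `C > 0`, ANY budget `B > 0` (`expMomentsFlat_window`): LEAD g17's chessboard rung `torusE_exp_two_mul_sum_carrierCl_le_of_const` at the constant `C·β`
  gives the budget `12R⁴(2R+4)⁴(1944 + 144 log β/(2L+1))/(Cβ) → 0`; `expMomentsFlat_of_femtoTail` glues it to the tail.

So after the flat reshape the measure side of «coldwall_pure» is: TWO binders, each a THEOREM below `β^{1/8−}` and OPEN on the femto tail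
`β^{1/9} ≲ R ≤ ℓ/uRec β` (background-field expansion; Gaussian concentration of the classical centre response at RUNNING coupling), plus the NT floors.

HONEST FRAMING: elementary consequences of landed lemmas; nothing of E0′, NT or the gap; YM mass gap NOT proved; not Clay.
-/

noncomputable section

open MeasureTheory Filter Topology Finset
open Literature.MathematicalPhysics.QuantumFieldTheory (GaugeConfig LatticeRep)
open Literature.MathematicalPhysics.QuantumLattice (fundamentalRep fundamentalLatticeRep LGConfig)
open Summit.QuantumFields.YangMills.Cruxes.OSLegsFromFemtoAndGap.DlrCollarTransfer
open Summit.QuantumFields.YangMills.Cruxes.UVSeamRec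
open Summit.QuantumFields.YangMills.Cruxes.UVSeamRec.ClassicalResponse
open Summit.QuantumFields.YangMills.Theorems.WeakCouplingRates (exists_const_mul_boxSide_pow_mul_rpow_le)

namespace Summit.QuantumFields.YangMills.Cruxes.UVSeamRec.ClassicalResponse.ColdWall

/-! ### §1 (CW♭) on the window, and from its tail -/

/-- **(CW♭) AT `(β, R)` FOR EVERY EXTERIOR, given the slop condition**: `β ≥ 1`, `0 < C_s ≤ C₁`, `(R⁴/C₁)·120(2R+3)⁴(38 + 12 log β)/β ≤ A₂` ⇒
`(R⁴/C₁)|kerE^η(plane q x) − kerE^𝟙(plane q x)| ≤ A₂ + carrierCl C_s 1 1 R q x η` (LEAD g16's `coldWallSplit_inequality_of_slop_le` at the constant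
`C_s·β`; `carrierCl (C_s β) 1 β R = carrierCl C_s 1 1 R`). [folklore] -/
theorem coldWallSplitFlat_inequality_of_slop_le {β : ℝ} (hβ : 1 ≤ β) {C_s C₁ A₂ : ℝ} (hCs : 0 < C_s) (hC₁ : 0 < C₁) (hCC : C_s ≤ C₁)
    (R : ℕ) (hslop : (R : ℝ) ^ 4 / C₁ * (120 * ((2 * R + 3 : ℕ) : ℝ) ^ 4 * ((38 + 12 * Real.log β) / β)) ≤ A₂)
    (q : Fin 4 × Fin 4) (hq : q.1 < q.2) (x : Fin 4 → ℤ) (η : LGConfig 4 (Matrix.specialUnitaryGroup (Fin 2) ℂ)) :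
    (R : ℝ) ^ 4 / C₁ * |kerE (Matrix.specialUnitaryGroup (Fin 2) ℂ) (fundamentalLatticeRep 2) β (fun k => x k - (R + 1)) (2 * R + 3) η
          (plane (Matrix.specialUnitaryGroup (Fin 2) ℂ) (fundamentalLatticeRep 2) q x) -
        kerE (Matrix.specialUnitaryGroup (Fin 2) ℂ) (fundamentalLatticeRep 2) β (fun k => x k - (R + 1)) (2 * R + 3) 1
          (plane (Matrix.specialUnitaryGroup (Fin 2) ℂ) (fundamentalLatticeRep 2) q x)| ≤
      A₂ + carrierCl (fundamentalLatticeRep 2) C_s 1 1 R q x η := by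
  have hβ0 : 0 < β := by linarith
  have hCβ : C_s * β ≤ C₁ * β := mul_le_mul_of_nonneg_right hCC hβ0.le
  have h := coldWallSplit_inequality_of_slop_le hβ (mul_pos hCs hβ0) hC₁ hCβ R hslop q hq x η
  have e : carrierCl (fundamentalLatticeRep 2) (C_s * β) 1 β R q x η = carrierCl (fundamentalLatticeRep 2) C_s 1 1 R q x η := by
    unfold carrierCl
    field_simp
  rwa [e] at h

/-- **(CW♭) FOR EVERY EXTERIOR ON THE WHOLE WINDOW `R + 1 ≤ ⌈β^θ⌉`, `0 < θ < 1/8`**: for `0 < C_s ≤ C₁`, `A₂ > 0` there is `β₂ ≥ 1` with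
`(R⁴/C₁)|kerE^η(plane q x) − kerE^𝟙(plane q x)| ≤ A₂ + carrierCl C_s 1 1 R q x η` for all `β ≥ β₂`, `R + 1 ≤ ⌈β^θ⌉`, `q.1 < q.2`, `x`, `η`
(slop bound `slop_le_of_window`). [folklore] -/
theorem coldWallSplitFlat_window {θ : ℝ} (hθ : 0 < θ) (hθ₈ : θ < 1 / 8) {C_s C₁ A₂ : ℝ} (hCs : 0 < C_s) (hC₁ : 0 < C₁) (hCC : C_s ≤ C₁)
    (hA₂ : 0 < A₂) :
    ∃ β₂ : ℝ, 1 ≤ β₂ ∧ ∀ β : ℝ, β₂ ≤ β → ∀ R : ℕ, R + 1 ≤ ⌈β ^ θ⌉₊ → ∀ (q : Fin 4 × Fin 4) (x : Fin 4 → ℤ), q.1 < q.2 →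
      ∀ η : LGConfig 4 (Matrix.specialUnitaryGroup (Fin 2) ℂ),
        (R : ℝ) ^ 4 / C₁ * |kerE (Matrix.specialUnitaryGroup (Fin 2) ℂ) (fundamentalLatticeRep 2) β (fun k => x k - (R + 1)) (2 * R + 3) η
              (plane (Matrix.specialUnitaryGroup (Fin 2) ℂ) (fundamentalLatticeRep 2) q x) -
            kerE (Matrix.specialUnitaryGroup (Fin 2) ℂ) (fundamentalLatticeRep 2) β (fun k => x k - (R + 1)) (2 * R + 3) 1
              (plane (Matrix.specialUnitaryGroup (Fin 2) ℂ) (fundamentalLatticeRep 2) q x)| ≤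
          A₂ + carrierCl (fundamentalLatticeRep 2) C_s 1 1 R q x η := by
  obtain ⟨β₀, hβ₀1, hslop⟩ := slop_le_of_window hθ hθ₈ (K := C₁ * A₂) (mul_pos hC₁ hA₂)
  refine ⟨β₀, hβ₀1, fun β hβ R hR q x hq η => ?_⟩
  have hβ1 : 1 ≤ β := hβ₀1.trans hβ
  refine coldWallSplitFlat_inequality_of_slop_le hβ1 hCs hC₁ hCC R ?_ q hq x η
  have h := hslop β hβ R hR
  rw [div_mul_eq_mul_div, div_le_iff₀ hC₁]
  linarith

/-- **(CW♭) ⟸ ITS FEMTO TAIL.**  If the flat cold-wall split holds on the TAIL window `⌈β^{1/9}⌉ ≤ R + 2 ∧ R·uRec β ≤ ℓ₂` (its own ∃-constants, with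
`C_s ≤ C₁`), then it holds on the whole femto window `1 ≤ R ∧ R·uRec β ≤ ℓ₂` (`A₂ ↦ A₂ + 1`, larger onset). [folklore] -/
theorem coldWallSplitFlat_of_femtoTail
    (htail : ∃ (C_s C₁ A₂ β₂ ℓ₂ : ℝ), 0 < C_s ∧ C_s ≤ C₁ ∧ 0 ≤ A₂ ∧ 0 < ℓ₂ ∧
      ∀ β : ℝ, β₂ ≤ β → ∀ R : ℕ, 1 ≤ R → ⌈β ^ (1 / 9 : ℝ)⌉₊ ≤ R + 2 → (R : ℝ) * Transport.uRec β ≤ ℓ₂ →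
      ∀ (q : Fin 4 × Fin 4) (x : Fin 4 → ℤ), q.1 < q.2 → ∀ η : LGConfig 4 (Matrix.specialUnitaryGroup (Fin 2) ℂ),
      (R : ℝ) ^ 4 / C₁ * |kerE (Matrix.specialUnitaryGroup (Fin 2) ℂ) (fundamentalLatticeRep 2) β (fun k => x k - (R + 1)) (2 * R + 3) η
          (plane (Matrix.specialUnitaryGroup (Fin 2) ℂ) (fundamentalLatticeRep 2) q x) -
        kerE (Matrix.specialUnitaryGroup (Fin 2) ℂ) (fundamentalLatticeRep 2) β (fun k => x k - (R + 1)) (2 * R + 3) 1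
          (plane (Matrix.specialUnitaryGroup (Fin 2) ℂ) (fundamentalLatticeRep 2) q x)| ≤
        A₂ + carrierCl (fundamentalLatticeRep 2) C_s 1 1 R q x η) :
    ∃ (C_s C₁ A₂ β₂ ℓ₂ : ℝ), 0 < C_s ∧ 0 < C₁ ∧ 0 ≤ A₂ ∧ 0 < ℓ₂ ∧
      ∀ β : ℝ, β₂ ≤ β → ∀ R : ℕ, 1 ≤ R → (R : ℝ) * Transport.uRec β ≤ ℓ₂ →
      ∀ (q : Fin 4 × Fin 4) (x : Fin 4 → ℤ), q.1 < q.2 → ∀ η : LGConfig 4 (Matrix.specialUnitaryGroup (Fin 2) ℂ),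
      (R : ℝ) ^ 4 / C₁ * |kerE (Matrix.specialUnitaryGroup (Fin 2) ℂ) (fundamentalLatticeRep 2) β (fun k => x k - (R + 1)) (2 * R + 3) η
          (plane (Matrix.specialUnitaryGroup (Fin 2) ℂ) (fundamentalLatticeRep 2) q x) -
        kerE (Matrix.specialUnitaryGroup (Fin 2) ℂ) (fundamentalLatticeRep 2) β (fun k => x k - (R + 1)) (2 * R + 3) 1
          (plane (Matrix.specialUnitaryGroup (Fin 2) ℂ) (fundamentalLatticeRep 2) q x)| ≤
        A₂ + carrierCl (fundamentalLatticeRep 2) C_s 1 1 R q x η := by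
  obtain ⟨C_s, C₁, A₂, β₂, ℓ₂, hCs, hCC, hA₂, hℓ₂, htail⟩ := htail
  have hC₁ : 0 < C₁ := hCs.trans_le hCC
  obtain ⟨βw, -, hw⟩ := coldWallSplitFlat_window (θ := 1 / 9) (by norm_num) (by norm_num) hCs hC₁ hCC (show 0 < A₂ + 1 by linarith)
  refine ⟨C_s, C₁, A₂ + 1, max β₂ βw, ℓ₂, hCs, hC₁, by linarith, hℓ₂, fun β hβ R hR hRu q x hq η => ?_⟩
  by_cases htl : ⌈β ^ (1 / 9 : ℝ)⌉₊ ≤ R + 2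
  · have h := htail β ((le_max_left _ _).trans hβ) R hR htl hRu q x hq η
    linarith
  · push Not at htl
    exact hw β ((le_max_right _ _).trans hβ) R (by omega) q x hq η

/-! ### §2 (EM♭) on the window, and from its tail -/

/-- **(EM♭) AT `(β, R, L)` FROM THE CHESSBOARD RUNG**: for `β ≥ 4`, `24R⁴ ≤ C·β`, `4R+8 ≤ L`, every cyclically `2R+4`-separated family and every `T`,
`⟨exp(2 Σ_{i∈T} carrierCl C 1 1 R (q i) (x i))⟩_{2L+1,β} ≤ exp(12R⁴(2R+4)⁴(1944 + 144 log β/(2L+1))/(Cβ)·#T)` (LEAD g17's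
`torusE_exp_two_mul_sum_carrierCl_le_of_const` at the constant `C·β`). [folklore] -/
theorem torusE_exp_two_mul_sum_carrierCl_one_le {β : ℝ} (hβ : 4 ≤ β) {L n : ℕ} (q : Fin n → Fin 4 × Fin 4)
    (x : Fin n → (Fin 4 → ℤ)) {R : ℕ} (hq : ∀ i, (q i).1 < (q i).2) (hR : 1 ≤ R) (hRL : 4 * R + 8 ≤ L)
    (hsep : ∀ i j : Fin n, i ≠ j → ∃ k : Fin 4,
      (2 * (R : ℤ) + 4) ≤ |((((x i k - x j k : ℤ) : ZMod (2 * L + 1))).valMinAbs : ℤ)|)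
    {C : ℝ} (hC : 24 * (R : ℝ) ^ 4 ≤ C * β) (T : Finset (Fin n)) :
    torusE (Matrix.specialUnitaryGroup (Fin 2) ℂ) (fundamentalLatticeRep 2) β L
        (fun U => Real.exp (((2 : ℕ) : ℝ) * ∑ i ∈ T, carrierCl (fundamentalLatticeRep 2) C 1 1 R (q i) (x i) U)) ≤
      Real.exp (12 * (R : ℝ) ^ 4 * (2 * R + 4) ^ 4 * (1944 + 144 * Real.log β / (2 * L + 1 : ℕ)) / (C * β) * #T) := by
  have hβ0 : β ≠ 0 := by positivity
  have h := torusE_exp_two_mul_sum_carrierCl_le_of_const hβ q x hq hR hRL hsep hC T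
  have e : (fun U : LGConfig 4 (Matrix.specialUnitaryGroup (Fin 2) ℂ) =>
      Real.exp (((2 : ℕ) : ℝ) * ∑ i ∈ T, carrierCl (fundamentalLatticeRep 2) (C * β) 1 β R (q i) (x i) U)) =
      fun U => Real.exp (((2 : ℕ) : ℝ) * ∑ i ∈ T, carrierCl (fundamentalLatticeRep 2) C 1 1 R (q i) (x i) U) := by
    funext U
    refine congrArg Real.exp (congrArg _ (Finset.sum_congr rfl fun i _ => ?_))
    unfold carrierCl
    field_simp
  rwa [e] at h

/-- `log β ≤ β^ε/ε` and `1 ≤ β^ε` give `1944 + 144 log β ≤ (1944 + 144/ε)·β^ε` for `β ≥ 1`, `ε > 0`. [folklore] -/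
theorem budget_numerator_le_rpow {β ε : ℝ} (hβ : 1 ≤ β) (hε : 0 < ε) :
    1944 + 144 * Real.log β ≤ (1944 + 144 / ε) * β ^ ε := by
  have hβ0 : 0 < β := by linarith
  have h1 : Real.log β ≤ β ^ ε / ε := Real.log_le_rpow_div hβ0.le hε
  have h2 : 1 ≤ β ^ ε := Real.one_le_rpow hβ hε.le
  have h4 : 144 * Real.log β ≤ 144 / ε * β ^ ε := by
    calc 144 * Real.log β ≤ 144 * (β ^ ε / ε) := mul_le_mul_of_nonneg_left h1 (by norm_num)
      _ = 144 / ε * β ^ ε := by ring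
  nlinarith [h2, h4, hε]

/-- **(EM♭) ON THE WHOLE WINDOW `R + 2 ≤ ⌈β^θ⌉`, `0 < θ < 1/8`, ANY CONSTANT, ANY BUDGET.**  For `C > 0`, `B > 0` there is `β₁ ≥ 4` such that for all
`β ≥ β₁`, all odd tori and admissible families with `1 ≤ R`, `R + 2 ≤ ⌈β^θ⌉`, `4R+8 ≤ L`:
`⟨exp(2 Σ_{i∈T} carrierCl C 1 1 R (q i) (x i))⟩_{2L+1,β} ≤ e^{B·#T}`.  (`R⁴(2R+4)⁴ ≤ (2⌈β^θ⌉+3)⁸`, `1944 + 144 log β/(2L+1) ≤ (1944+144/ε)β^ε`,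
`ε = (1−8θ)/2`, so the budget is `≤ (12(1944+144/ε)/C)·(2⌈β^θ⌉+3)⁸·β^{ε−1} ≤ B` eventually; `24R⁴ ≤ Cβ` eventually likewise.) [folklore] -/
theorem expMomentsFlat_window {θ : ℝ} (hθ : 0 < θ) (hθ₈ : θ < 1 / 8) {C B : ℝ} (hC : 0 < C) (hB : 0 < B) :
    ∃ β₁ : ℝ, 4 ≤ β₁ ∧ ∀ β : ℝ, β₁ ≤ β → ∀ (L n : ℕ) (q : Fin n → Fin 4 × Fin 4) (x : Fin n → (Fin 4 → ℤ)) (R : ℕ),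
      (∀ i, (q i).1 < (q i).2) → 1 ≤ R → R + 2 ≤ ⌈β ^ θ⌉₊ → 4 * R + 8 ≤ L →
      (∀ i j : Fin n, i ≠ j → ∃ k : Fin 4,
        (2 * (R : ℤ) + 4) ≤ |((((x i k - x j k : ℤ) : ZMod (2 * L + 1))).valMinAbs : ℤ)|) →
      ∀ T : Finset (Fin n),
        torusE (Matrix.specialUnitaryGroup (Fin 2) ℂ) (fundamentalLatticeRep 2) β L
          (fun U => Real.exp (((2 : ℕ) : ℝ) * ∑ i ∈ T, carrierCl (fundamentalLatticeRep 2) C 1 1 R (q i) (x i) U)) ≤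
          Real.exp (B * T.card) := by
  set ε : ℝ := (1 - 8 * θ) / 2 with hεdef
  have hε : 0 < ε := by rw [hεdef]; linarith
  -- budget: `(12(1944+144/ε)/(C B))·S⁸·β^{ε−1} ≤ β⁰`
  obtain ⟨b₁, hb₁1, E1⟩ := exists_const_mul_boxSide_pow_mul_rpow_le (12 * (1944 + 144 / ε) / (C * B)) 8 (θ := θ) (a := ε - 1) (b := 0) hθ
    (by rw [hεdef]; push_cast; linarith)
  -- side condition `24R⁴ ≤ Cβ`: `(24/C)·S⁴·β⁰ ≤ β¹`
  obtain ⟨b₂, hb₂1, E2⟩ := exists_const_mul_boxSide_pow_mul_rpow_le (24 / C) 4 (θ := θ) (a := 0) (b := 1) hθ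
    (by push_cast; linarith)
  refine ⟨max 4 (max b₁ b₂), le_max_left _ _, fun β hβ L n q x R hq hR hRw hRL hsep T => ?_⟩
  have hβ4 : 4 ≤ β := (le_max_left _ _).trans hβ
  have hb1 : b₁ ≤ β := (le_max_left _ _).trans ((le_max_right _ _).trans hβ)
  have hb2 : b₂ ≤ β := (le_max_right _ _).trans ((le_max_right _ _).trans hβ)
  have hβ1 : 1 ≤ β := by linarith
  have hβ0 : 0 < β := by linarith
  set S : ℝ := 2 * (⌈β ^ θ⌉₊ : ℝ) + 3 with hSdef
  have hRS : (R : ℝ) ≤ S := by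
    have h : (R : ℝ) + 2 ≤ (⌈β ^ θ⌉₊ : ℝ) := by exact_mod_cast hRw
    rw [hSdef]; linarith [(Nat.cast_nonneg R : (0 : ℝ) ≤ R)]
  have hbS : (2 * (R : ℝ) + 4) ≤ S := by
    have h : (R : ℝ) + 2 ≤ (⌈β ^ θ⌉₊ : ℝ) := by exact_mod_cast hRw
    rw [hSdef]; linarith
  have hR0 : (0 : ℝ) ≤ R := Nat.cast_nonneg R
  have hR4S : (R : ℝ) ^ 4 ≤ S ^ 4 := pow_le_pow_left₀ hR0 hRS 4
  have hside : 24 * (R : ℝ) ^ 4 ≤ C * β := by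
    have e2 := E2 β hb2
    rw [Real.rpow_zero, mul_one, Real.rpow_one] at e2
    have h1 : 24 / C * (R : ℝ) ^ 4 ≤ 24 / C * S ^ 4 := mul_le_mul_of_nonneg_left hR4S (by positivity)
    have h2 : 24 / C * (R : ℝ) ^ 4 ≤ β := h1.trans e2
    rw [div_mul_eq_mul_div, div_le_iff₀ hC] at h2
    linarith
  refine (torusE_exp_two_mul_sum_carrierCl_one_le hβ4 q x hq hR hRL hsep hside T).trans (Real.exp_le_exp.2 ?_)
  refine mul_le_mul_of_nonneg_right ?_ (Nat.cast_nonneg _)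
  -- the budget bound
  have hR8 : (R : ℝ) ^ 4 * (2 * (R : ℝ) + 4) ^ 4 ≤ S ^ 8 := by
    rw [show S ^ 8 = S ^ 4 * S ^ 4 by ring]
    exact mul_le_mul hR4S (pow_le_pow_left₀ (by positivity) hbS 4) (by positivity) (by positivity)
  have hM1 : (1 : ℝ) ≤ ((2 * L + 1 : ℕ) : ℝ) := by exact_mod_cast (show 1 ≤ 2 * L + 1 by omega)
  have hlog0 : 0 ≤ Real.log β := Real.log_nonneg hβ1
  have hnum : 1944 + 144 * Real.log β / ((2 * L + 1 : ℕ) : ℝ) ≤ (1944 + 144 / ε) * β ^ ε := by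
    have h1 : 144 * Real.log β / ((2 * L + 1 : ℕ) : ℝ) ≤ 144 * Real.log β :=
      div_le_self (by positivity) hM1
    linarith [budget_numerator_le_rpow hβ1 hε]
  have hnum0 : 0 ≤ 1944 + 144 * Real.log β / ((2 * L + 1 : ℕ) : ℝ) := by positivity
  have e1 := E1 β hb1
  rw [Real.rpow_zero] at e1
  have hε1 : β ^ ε / β = β ^ (ε - 1) := by rw [Real.rpow_sub_one hβ0.ne']
  calc 12 * (R : ℝ) ^ 4 * (2 * R + 4) ^ 4 * (1944 + 144 * Real.log β / (2 * L + 1 : ℕ)) / (C * β)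
      = 12 / C * ((R : ℝ) ^ 4 * (2 * (R : ℝ) + 4) ^ 4) * (1944 + 144 * Real.log β / (2 * L + 1 : ℕ)) / β := by
        field_simp
    _ ≤ 12 / C * S ^ 8 * ((1944 + 144 / ε) * β ^ ε) / β := by gcongr
    _ = B * (12 * (1944 + 144 / ε) / (C * B) * S ^ 8 * β ^ (ε - 1)) := by
        rw [← hε1]; field_simp
    _ ≤ B * 1 := mul_le_mul_of_nonneg_left e1 hB.le
    _ = B := mul_one _

/-- **(EM♭) ⟸ ITS FEMTO TAIL.**  If the flat exponential-moment bound holds (with its own ∃-constants) on the TAIL `⌈β^{1/9}⌉ ≤ R + 2 ∧ R·uRec β ≤ ℓ₁`,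
then it holds on the whole femto window `1 ≤ R ∧ R·uRec β ≤ ℓ₁` (budget `max B 1`, larger onset): below the tail §2 applies with `θ = 1/9`. [folklore] -/
theorem expMomentsFlat_of_femtoTail
    (htail : ∃ (C B β₁ ℓ₁ : ℝ), 0 < C ∧ 0 < ℓ₁ ∧
      ∀ β : ℝ, β₁ ≤ β → ∀ (L n : ℕ) (q : Fin n → Fin 4 × Fin 4) (x : Fin n → (Fin 4 → ℤ)) (R : ℕ),
      (∀ i, (q i).1 < (q i).2) → 1 ≤ R → ⌈β ^ (1 / 9 : ℝ)⌉₊ ≤ R + 2 → (R : ℝ) * Transport.uRec β ≤ ℓ₁ → 4 * R + 8 ≤ L →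
      (∀ i j : Fin n, i ≠ j → ∃ k : Fin 4,
        (2 * (R : ℤ) + 4) ≤ |((((x i k - x j k : ℤ) : ZMod (2 * L + 1))).valMinAbs : ℤ)|) →
      ∀ T : Finset (Fin n),
        torusE (Matrix.specialUnitaryGroup (Fin 2) ℂ) (fundamentalLatticeRep 2) β L
          (fun U => Real.exp (((2 : ℕ) : ℝ) * ∑ i ∈ T, carrierCl (fundamentalLatticeRep 2) C 1 1 R (q i) (x i) U)) ≤
          Real.exp (B * T.card)) :
    ∃ (C B β₁ ℓ₁ : ℝ), 0 < C ∧ 0 < ℓ₁ ∧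
      ∀ β : ℝ, β₁ ≤ β → ∀ (L n : ℕ) (q : Fin n → Fin 4 × Fin 4) (x : Fin n → (Fin 4 → ℤ)) (R : ℕ),
      (∀ i, (q i).1 < (q i).2) → 1 ≤ R → (R : ℝ) * Transport.uRec β ≤ ℓ₁ → 4 * R + 8 ≤ L →
      (∀ i j : Fin n, i ≠ j → ∃ k : Fin 4,
        (2 * (R : ℤ) + 4) ≤ |((((x i k - x j k : ℤ) : ZMod (2 * L + 1))).valMinAbs : ℤ)|) →
      ∀ T : Finset (Fin n),
        torusE (Matrix.specialUnitaryGroup (Fin 2) ℂ) (fundamentalLatticeRep 2) β L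
          (fun U => Real.exp (((2 : ℕ) : ℝ) * ∑ i ∈ T, carrierCl (fundamentalLatticeRep 2) C 1 1 R (q i) (x i) U)) ≤
          Real.exp (B * T.card) := by
  obtain ⟨C, B, β₁, ℓ₁, hC, hℓ₁, htail⟩ := htail
  obtain ⟨βw, -, hw⟩ := expMomentsFlat_window (θ := 1 / 9) (by norm_num) (by norm_num) hC one_pos
  refine ⟨C, max B 1, max β₁ βw, ℓ₁, hC, hℓ₁, fun β hβ L n q x R hq hR hRu hRL hsep T => ?_⟩
  have hT : (0 : ℝ) ≤ T.card := Nat.cast_nonneg _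
  by_cases htl : ⌈β ^ (1 / 9 : ℝ)⌉₊ ≤ R + 2
  · refine (htail β ((le_max_left _ _).trans hβ) L n q x R hq hR htl hRu hRL hsep T).trans (Real.exp_le_exp.2 ?_)
    exact mul_le_mul_of_nonneg_right (le_max_left _ _) hT
  · push Not at htl
    refine (hw β ((le_max_right _ _).trans hβ) L n q x R hq hR (by omega) hRL hsep T).trans (Real.exp_le_exp.2 ?_)
    exact mul_le_mul_of_nonneg_right (le_max_right _ _) hT

/-! ### §3 (appended, LEAD g18) The same two windows in the EXACT letters of ym-idea-10 g3's line «classical_dominance» -/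

/-- **(CM) — `stub_classicalMoments` of `Lines/classical_dominance.lean` — ON THE WINDOW `R + 2 ≤ ⌈β^θ⌉`, `0 < θ < 1/8`, ANY `C₀ > 0`, ANY BUDGET `B > 0`**:
`⟨exp(Σ_{i∈T} (R⁴/C₀)·classicalResponse_i(U))⟩_{2L+1,β} ≤ e^{B·#T}` for `β ≥ β₁(θ, C₀, B)`, all odd tori, `1 ≤ R`, `R + 2 ≤ ⌈β^θ⌉`, `4R+8 ≤ L`, separated
families (`expMomentsFlat_window` at `C = 2C₀`: `2·carrierCl (2C₀) 1 1 R = (R⁴/C₀)·classicalResponse`).  So below its femto tail (CM) is a THEOREM, exactly as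
(SD) is (`classicalDominance_window`, LEAD g16). [folklore] -/
theorem classicalMoments_window {θ : ℝ} (hθ : 0 < θ) (hθ₈ : θ < 1 / 8) {C₀ B : ℝ} (hC₀ : 0 < C₀) (hB : 0 < B) :
    ∃ β₁ : ℝ, 4 ≤ β₁ ∧ ∀ β : ℝ, β₁ ≤ β → ∀ (L n : ℕ) (q : Fin n → Fin 4 × Fin 4) (x : Fin n → (Fin 4 → ℤ)) (R : ℕ),
      (∀ i, (q i).1 < (q i).2) → 1 ≤ R → R + 2 ≤ ⌈β ^ θ⌉₊ → 4 * R + 8 ≤ L →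
      (∀ i j : Fin n, i ≠ j → ∃ k : Fin 4,
        (2 * (R : ℤ) + 4) ≤ |((((x i k - x j k : ℤ) : ZMod (2 * L + 1))).valMinAbs : ℤ)|) →
      ∀ T : Finset (Fin n),
        torusE (Matrix.specialUnitaryGroup (Fin 2) ℂ) (fundamentalLatticeRep 2) β L
          (fun U => Real.exp (∑ i ∈ T, (R : ℝ) ^ 4 / C₀ *
            classicalResponse (fundamentalLatticeRep 2) (fun k => x i k - (R + 1)) (2 * R + 3) (q i) (x i) 1 U)) ≤ Real.exp (B * T.card) := by
  obtain ⟨β₁, hβ₁4, h⟩ := expMomentsFlat_window hθ hθ₈ (C := 2 * C₀) (by positivity) hB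
  refine ⟨β₁, hβ₁4, fun β hβ L n q x R hq hR hRw hRL hsep T => ?_⟩
  have e : (fun U : LGConfig 4 (Matrix.specialUnitaryGroup (Fin 2) ℂ) => Real.exp (∑ i ∈ T, (R : ℝ) ^ 4 / C₀ *
        classicalResponse (fundamentalLatticeRep 2) (fun k => x i k - (R + 1)) (2 * R + 3) (q i) (x i) 1 U)) =
      fun U => Real.exp (((2 : ℕ) : ℝ) * ∑ i ∈ T, carrierCl (fundamentalLatticeRep 2) (2 * C₀) 1 1 R (q i) (x i) U) := by
    funext U
    refine congrArg Real.exp ?_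
    rw [Finset.mul_sum]
    refine Finset.sum_congr rfl fun i _ => ?_
    unfold carrierCl
    push_cast
    field_simp
  rw [e]
  exact h β hβ L n q x R hq hR hRw hRL hsep T

/-- **(CM) ⟸ ITS FEMTO TAIL** in the letters of `stub_classicalMoments`: if the (CM) sentence holds (own ∃-constants) on the tail `⌈β^{1/9}⌉ ≤ R + 2`, it holds on
the whole femto window (budget `max B 1`, larger onset). [folklore] -/
theorem classicalMoments_of_femtoTail
    (htail : ∃ (C₀ B β₁ ℓ₁ : ℝ), 0 < C₀ ∧ 0 < ℓ₁ ∧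
      ∀ β : ℝ, β₁ ≤ β → ∀ (L n : ℕ) (q : Fin n → Fin 4 × Fin 4) (x : Fin n → (Fin 4 → ℤ)) (R : ℕ),
      (∀ i, (q i).1 < (q i).2) → 1 ≤ R → ⌈β ^ (1 / 9 : ℝ)⌉₊ ≤ R + 2 → (R : ℝ) * Transport.uRec β ≤ ℓ₁ → 4 * R + 8 ≤ L →
      (∀ i j : Fin n, i ≠ j → ∃ k : Fin 4,
        (2 * (R : ℤ) + 4) ≤ |((((x i k - x j k : ℤ) : ZMod (2 * L + 1))).valMinAbs : ℤ)|) →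
      ∀ T : Finset (Fin n),
        torusE (Matrix.specialUnitaryGroup (Fin 2) ℂ) (fundamentalLatticeRep 2) β L
          (fun U => Real.exp (∑ i ∈ T, (R : ℝ) ^ 4 / C₀ *
            classicalResponse (fundamentalLatticeRep 2) (fun k => x i k - (R + 1)) (2 * R + 3) (q i) (x i) 1 U)) ≤ Real.exp (B * T.card)) :
    ∃ (C₀ B β₁ ℓ₁ : ℝ), 0 < C₀ ∧ 0 < ℓ₁ ∧
      ∀ β : ℝ, β₁ ≤ β → ∀ (L n : ℕ) (q : Fin n → Fin 4 × Fin 4) (x : Fin n → (Fin 4 → ℤ)) (R : ℕ),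
      (∀ i, (q i).1 < (q i).2) → 1 ≤ R → (R : ℝ) * Transport.uRec β ≤ ℓ₁ → 4 * R + 8 ≤ L →
      (∀ i j : Fin n, i ≠ j → ∃ k : Fin 4,
        (2 * (R : ℤ) + 4) ≤ |((((x i k - x j k : ℤ) : ZMod (2 * L + 1))).valMinAbs : ℤ)|) →
      ∀ T : Finset (Fin n),
        torusE (Matrix.specialUnitaryGroup (Fin 2) ℂ) (fundamentalLatticeRep 2) β L
          (fun U => Real.exp (∑ i ∈ T, (R : ℝ) ^ 4 / C₀ *
            classicalResponse (fundamentalLatticeRep 2) (fun k => x i k - (R + 1)) (2 * R + 3) (q i) (x i) 1 U)) ≤ Real.exp (B * T.card) := by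
  obtain ⟨C₀, B, β₁, ℓ₁, hC₀, hℓ₁, htail⟩ := htail
  obtain ⟨βw, -, hw⟩ := classicalMoments_window (θ := 1 / 9) (by norm_num) (by norm_num) hC₀ one_pos
  refine ⟨C₀, max B 1, max β₁ βw, ℓ₁, hC₀, hℓ₁, fun β hβ L n q x R hq hR hRu hRL hsep T => ?_⟩
  have hT : (0 : ℝ) ≤ T.card := Nat.cast_nonneg _
  by_cases htl : ⌈β ^ (1 / 9 : ℝ)⌉₊ ≤ R + 2
  · refine (htail β ((le_max_left _ _).trans hβ) L n q x R hq hR htl hRu hRL hsep T).trans (Real.exp_le_exp.2 ?_)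
    exact mul_le_mul_of_nonneg_right (le_max_left _ _) hT
  · push Not at htl
    refine (hw β ((le_max_right _ _).trans hβ) L n q x R hq hR (by omega) hRL hsep T).trans (Real.exp_le_exp.2 ?_)
    exact mul_le_mul_of_nonneg_right (le_max_right _ _) hT

/-! ### §4 (appended, LEAD g18) The open content of (SD-tail) is CALM-CENTRE exteriors only -/

/-- **(SD)∕(CW♭) is TRIVIAL for exteriors with LARGE classical response**: both centre deficits lie in `[0, 2N] = [0, 4]`, so
`|kerE^η(plane q x) − kerE^𝟙(plane q x)| ≤ 4`; hence whenever `classicalResponse₁(η) ≥ 4C_s/C₁` the β-free payment `carrierCl C_s 1 1 R = R⁴cr/C_s ≥ 4R⁴/C₁`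
already exceeds the left side (any `A₂ ≥ 0`, any `β`, any `R`).  The tail stub's open content is therefore the CALM-CENTRE class `cr < 4C_s/C₁`. [folklore] -/
theorem coldWallSplitFlat_of_large_response {β C_s C₁ A₂ : ℝ} (hCs : 0 < C_s) (hC₁ : 0 < C₁) (hA₂ : 0 ≤ A₂) (R : ℕ) (q : Fin 4 × Fin 4)
    (x : Fin 4 → ℤ) (η : LGConfig 4 (Matrix.specialUnitaryGroup (Fin 2) ℂ))
    (hcr : 4 * C_s / C₁ ≤ classicalResponse (fundamentalLatticeRep 2) (fun k => x k - (R + 1)) (2 * R + 3) q x 1 η) :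
    (R : ℝ) ^ 4 / C₁ * |kerE (Matrix.specialUnitaryGroup (Fin 2) ℂ) (fundamentalLatticeRep 2) β (fun k => x k - (R + 1)) (2 * R + 3) η
          (plane (Matrix.specialUnitaryGroup (Fin 2) ℂ) (fundamentalLatticeRep 2) q x) -
        kerE (Matrix.specialUnitaryGroup (Fin 2) ℂ) (fundamentalLatticeRep 2) β (fun k => x k - (R + 1)) (2 * R + 3) 1
          (plane (Matrix.specialUnitaryGroup (Fin 2) ℂ) (fundamentalLatticeRep 2) q x)| ≤
      A₂ + carrierCl (fundamentalLatticeRep 2) C_s 1 1 R q x η := by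
  have hN : ((fundamentalLatticeRep 2).N : ℝ) = 2 := by simp
  have hη := kerE_deficit_mem_Icc (r := fundamentalLatticeRep 2) β (fun k => x k - ((R : ℤ) + 1)) (2 * R + 3) η q x
  have h1 := kerE_deficit_mem_Icc (r := fundamentalLatticeRep 2) β (fun k => x k - ((R : ℤ) + 1)) (2 * R + 3) (1 : LGConfig 4 (Matrix.specialUnitaryGroup (Fin 2) ℂ)) q x
  rw [kerE_const_sub (r := fundamentalLatticeRep 2) β _ _ η (continuous_plane (fundamentalLatticeRep 2) q x)] at hη
  rw [kerE_const_sub (r := fundamentalLatticeRep 2) β _ _ (1 : LGConfig 4 (Matrix.specialUnitaryGroup (Fin 2) ℂ)) (continuous_plane (fundamentalLatticeRep 2) q x)] at h1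
  simp only [hN] at hη h1
  have habs : |kerE (Matrix.specialUnitaryGroup (Fin 2) ℂ) (fundamentalLatticeRep 2) β (fun k => x k - (R + 1)) (2 * R + 3) η (plane (Matrix.specialUnitaryGroup (Fin 2) ℂ) (fundamentalLatticeRep 2) q x) -
      kerE (Matrix.specialUnitaryGroup (Fin 2) ℂ) (fundamentalLatticeRep 2) β (fun k => x k - (R + 1)) (2 * R + 3) 1 (plane (Matrix.specialUnitaryGroup (Fin 2) ℂ) (fundamentalLatticeRep 2) q x)| ≤ 4 := by
    rw [abs_le]; constructor <;> linarith [hη.1, hη.2, h1.1, h1.2]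
  have hR4 : 0 ≤ (R : ℝ) ^ 4 := by positivity
  have hpay : (R : ℝ) ^ 4 / C₁ * 4 ≤ carrierCl (fundamentalLatticeRep 2) C_s 1 1 R q x η := by
    unfold carrierCl
    have h4 : (4 : ℝ) / C₁ ≤ classicalResponse (fundamentalLatticeRep 2) (fun k => x k - ((R : ℤ) + 1)) (2 * R + 3) q x 1 η / C_s := by
      rw [le_div_iff₀ hCs]
      calc 4 / C₁ * C_s = 4 * C_s / C₁ := by ring
        _ ≤ _ := hcr
    calc (R : ℝ) ^ 4 / C₁ * 4 = (R : ℝ) ^ 4 * (4 / C₁) := by ring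
      _ ≤ (R : ℝ) ^ 4 * (classicalResponse (fundamentalLatticeRep 2) (fun k => x k - ((R : ℤ) + 1)) (2 * R + 3) q x 1 η / C_s) :=
          mul_le_mul_of_nonneg_left h4 hR4
      _ = 1 * (R : ℝ) ^ 4 / C_s * classicalResponse (fundamentalLatticeRep 2) (fun k => x k - ((R : ℤ) + 1)) (2 * R + 3) q x 1 η := by ring
  calc (R : ℝ) ^ 4 / C₁ * |kerE (Matrix.specialUnitaryGroup (Fin 2) ℂ) (fundamentalLatticeRep 2) β (fun k => x k - (R + 1)) (2 * R + 3) η (plane (Matrix.specialUnitaryGroup (Fin 2) ℂ) (fundamentalLatticeRep 2) q x) -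
        kerE (Matrix.specialUnitaryGroup (Fin 2) ℂ) (fundamentalLatticeRep 2) β (fun k => x k - (R + 1)) (2 * R + 3) 1 (plane (Matrix.specialUnitaryGroup (Fin 2) ℂ) (fundamentalLatticeRep 2) q x)|
      ≤ (R : ℝ) ^ 4 / C₁ * 4 := mul_le_mul_of_nonneg_left habs (by positivity)
    _ ≤ carrierCl (fundamentalLatticeRep 2) C_s 1 1 R q x η := hpay
    _ ≤ A₂ + carrierCl (fundamentalLatticeRep 2) C_s 1 1 R q x η := le_add_of_nonneg_left hA₂

/-- **(SD-tail) ⟸ ITS CALM-CENTRE PART**: if the β-free cold-wall split holds on the tail for every exterior whose classical response is `< 4C_s/C₁`, it holds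
on the tail for EVERY exterior (same constants). [folklore] -/
theorem coldWallSplitFlat_tail_of_calm {C_s C₁ A₂ β₂ ℓ₂ : ℝ} (hCs : 0 < C_s) (hC₁ : 0 < C₁) (hA₂ : 0 ≤ A₂)
    (hcalm : ∀ β : ℝ, β₂ ≤ β → ∀ R : ℕ, 1 ≤ R → ⌈β ^ (1 / 9 : ℝ)⌉₊ ≤ R + 2 → (R : ℝ) * Transport.uRec β ≤ ℓ₂ →
      ∀ (q : Fin 4 × Fin 4) (x : Fin 4 → ℤ), q.1 < q.2 → ∀ η : LGConfig 4 (Matrix.specialUnitaryGroup (Fin 2) ℂ),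
      classicalResponse (fundamentalLatticeRep 2) (fun k => x k - (R + 1)) (2 * R + 3) q x 1 η < 4 * C_s / C₁ →
      (R : ℝ) ^ 4 / C₁ * |kerE (Matrix.specialUnitaryGroup (Fin 2) ℂ) (fundamentalLatticeRep 2) β (fun k => x k - (R + 1)) (2 * R + 3) η
          (plane (Matrix.specialUnitaryGroup (Fin 2) ℂ) (fundamentalLatticeRep 2) q x) -
        kerE (Matrix.specialUnitaryGroup (Fin 2) ℂ) (fundamentalLatticeRep 2) β (fun k => x k - (R + 1)) (2 * R + 3) 1
          (plane (Matrix.specialUnitaryGroup (Fin 2) ℂ) (fundamentalLatticeRep 2) q x)| ≤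
        A₂ + carrierCl (fundamentalLatticeRep 2) C_s 1 1 R q x η) :
    ∀ β : ℝ, β₂ ≤ β → ∀ R : ℕ, 1 ≤ R → ⌈β ^ (1 / 9 : ℝ)⌉₊ ≤ R + 2 → (R : ℝ) * Transport.uRec β ≤ ℓ₂ →
      ∀ (q : Fin 4 × Fin 4) (x : Fin 4 → ℤ), q.1 < q.2 → ∀ η : LGConfig 4 (Matrix.specialUnitaryGroup (Fin 2) ℂ),
      (R : ℝ) ^ 4 / C₁ * |kerE (Matrix.specialUnitaryGroup (Fin 2) ℂ) (fundamentalLatticeRep 2) β (fun k => x k - (R + 1)) (2 * R + 3) η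
          (plane (Matrix.specialUnitaryGroup (Fin 2) ℂ) (fundamentalLatticeRep 2) q x) -
        kerE (Matrix.specialUnitaryGroup (Fin 2) ℂ) (fundamentalLatticeRep 2) β (fun k => x k - (R + 1)) (2 * R + 3) 1
          (plane (Matrix.specialUnitaryGroup (Fin 2) ℂ) (fundamentalLatticeRep 2) q x)| ≤
        A₂ + carrierCl (fundamentalLatticeRep 2) C_s 1 1 R q x η := by
  intro β hβ R hR htl hRu q x hq η
  by_cases hc : classicalResponse (fundamentalLatticeRep 2) (fun k => x k - (R + 1)) (2 * R + 3) q x 1 η < 4 * C_s / C₁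
  · exact hcalm β hβ R hR htl hRu q x hq η hc
  · push Not at hc
    exact coldWallSplitFlat_of_large_response hCs hC₁ hA₂ R q x η hc

end Summit.QuantumFields.YangMills.Cruxes.UVSeamRec.ClassicalResponse.ColdWall

end
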